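import Mathlib
import Literature.Combinatorics.Enumerative.BinomialProductLucas
import HarnessLib

/-!
# Lucas congruences for the Apéry-like sequence `ρ_n` of the Lai–Sprang–Zudilin `ζ₂(5)`-approximations
([LaiSprangZudilin2026, (1.1) and Lemma 5.2]) — a corollary of [AdamczewskiBellDelaygue2019, Props. 7.4, 8.7]

Topic `Literature/Combinatorics/Enumerative`.  Everything in this file is PROVED (no named facts).

## Sources, as printed

L. Lai, J. Sprang, W. Zudilin, *A note on the irrationality of `ζ₂(5)`*, Int. Math. Res. Not. IMRN **2026**:16,
rnag180 = arXiv:2505.05005 [LaiSprangZudilin2026] (held text `paper:arxiv-2505.05005`, the author version v2 of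
26 May 2026 carrying the journal reference; locators below are to that text).

* §1, display (1.1) (p. 3): «our approximations satisfy a three-term Apéry-like recurrence relation
  `(n+1)^5 ρ_{n+1} − 32(2n+1)(8n^4+16n^3+20n^2+12n+3) ρ_n + 2^16 n^5 ρ_{n−1} = 0` for `n = 1, 2, …`.
  Apparently, this recursion did not show up in the literature before; it admits a solution
  `{ρ_0, ρ_1, ρ_2, …} = {1, 96, 14944, …}` which is integer-valued — we give an explicit binomial expression
  for the latter.»
* **Lemma 5.2** (p. 8): «The solution `(ρ_n)_{n≥0}` of the difference equation (1.1) with the initial conditions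
  `ρ_0 = 1`, `ρ_1 = 96` is given by the binomial double sum
  `ρ_n = Σ_{0≤i≤k≤n} 2^{4(n−k)} C(2i,i)^2 C(2n−2i,n−i) C(2k−2i,k−i) C(2k,k)^2 C(2n−2k,n−k)`.
  Furthermore, for the coefficients `ρ_{n,3}` … we have `ρ_{n,3} = 768 ρ_n ∈ ℤ` for `n ∈ ℤ_{≥0}`.»
  (`ρ_{n,3}` is the coefficient of `ζ₂(5)` in the linear forms `S_n = ρ_{n,0} + ρ_{n,3} ζ₂(5)` of their §4.)

B. Adamczewski, J. P. Bell, É. Delaygue, Ann. Sci. ÉNS (4) **52** (2019) 515–559 [AdamczewskiBellDelaygue2019],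
Prop. 8.7 (`p`-Lucas property of factorial ratios `Q_{e,f}` with `|e| = |f|` and `Δ_{e,f} ≥ 1` on `𝒟_{e,f}`, all
primes) and Prop. 7.4 (specialisation `x_i ↦ b_i x^{n_i}`, `𝐧 ∈ 𝒩`) — formalised for factorial ratios of binomial
type in `BinomialProductLucas` (`spec_binomProd_modEq_mul`, `spec_binomProd_modEq_prod_digits`), whose digit-form
hypotheses `CarryHyp` / `SumCarryHyp` we verify here.

## What is formalised (everything PROVED)

* `lszRho n` — THE DOUBLE SUM of Lemma 5.2, verbatim (so `lszRho` is `ρ_n` by that lemma; the recurrence (1.1)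
  itself is not formalised here); `lszRho_zero = 1`, `lszRho_one = 96`, `lszRho_two = 14944` (the printed values).
* In the composition variables `𝐱 = (x₀,x₁,x₂) := (i, k−i, n−k)`, `|𝐱| = n` (a bijection between the index set
  `0 ≤ i ≤ k ≤ n` and the compositions of `n` into three parts) the summand is `16^{x₂}` times the product of the
  seven central binomials `C(2𝐮_j·𝐱, 𝐮_j·𝐱)`, `𝐮_j·𝐱 ∈ {i, i, k−i, n−k, k, k, n−i}` (`uRho`), i.e.
  `ρ_n = Σ_{|𝐱|=n} 𝐛^𝐱 Q(𝐱)` with `𝐛 = (1,1,16)` (`bRho`): **`lszRho_eq_spec`**.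
* `noCarryRho` — the carry bookkeeping: with digits `v_i < p`, if none of the seven base-`p` additions
  `𝐮_j·𝐯 + 𝐮_j·𝐯` carries out of the units digit then `2(v₀+v₁) < p` and `2(v₁+v₂) < p` (so every top form is
  `< p` and `|𝐯| < p`); hence `carryHypRho : CarryHyp uRho uRho p` and `sumCarryHypRho : SumCarryHyp uRho uRho p`
  for EVERY `p` — the hypotheses of [AdamczewskiBellDelaygue2019, Props. 8.7, 7.4] for this factorial ratio
  (in real variables: if no `C(2y,y)`, `y ∈ {x₀,x₁,x₂,x₀+x₁,x₁+x₂}`, carries, i.e. all `{y} < ½`, then every form is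
  `< 1`, so `Δ ≥ 1` on `𝒟` and `(1,1,1) ∈ 𝒩`).
* **`lszRho_modEq_mul`** / **`lszRho_natModEq_mul`**: `ρ_{n₀+pN} ≡ ρ_{n₀} ρ_N (mod p)` for every prime `p` and
  `0 ≤ n₀ < p`; **`lszRho_modEq_prod_digits`**: `ρ_n ≡ ∏_i ρ_{n_i} (mod p)` over the base-`p` digits `n_i` of `n`.

This Lucas congruence is not stated in [LaiSprangZudilin2026] (whose §5 proves `d_n ρ_{n,3} ∈ ℤ`,
`d_n^6 ρ_{n,0} ∈ ℤ` and `v_p(ρ_{n,0}) ≥ −5` for large `p`, and records the expectation `d_n^5 ρ_{n,0} ∈ ℤ`) nor, to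
our knowledge, elsewhere in print — by §1 of the paper the sequence itself is new; it is the corollary of the
printed Lemma 5.2 and [AdamczewskiBellDelaygue2019, Props. 7.4, 8.7] obtained by the carry check `noCarryRho`,
exactly as for the Apéry numbers in [AdamczewskiBellDelaygue2019, §8.3.1].  Not covered: the identification of the
double sum with the solution of (1.1) (Lemma 5.2 itself, a terminating very-well-poised `₇F₆`/Andrews-transformation
identity), congruences modulo higher powers of `p` (Dwork / Gauss-type supercongruences), a constant-term
representation `ρ_n = ct[Λ^n]`, and the `2`-adic valuations of `ρ_n`.  Nearest existing declarations (used, not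
restated): `BinomialProductLucas.{dot, binomProd, spec, CarryHyp, SumCarryHyp, spec_binomProd_modEq_mul,
spec_binomProd_modEq_prod_digits}`; same method as `WellPoisedLeadingCoefficientLucas.krLeading61_modEq_mul`.
-/

namespace Literature.Combinatorics.Enumerative.TwoAdicZetaFiveAperyLikeLucas

open Finset BinomialProductLucas

/-! ## The sequence -/

/-- `ρ_n = Σ_{0≤i≤k≤n} 2^{4(n−k)} C(2i,i)² C(2n−2i,n−i) C(2k−2i,k−i) C(2k,k)² C(2n−2k,n−k)` — the binomial double
sum of [LaiSprangZudilin2026, Lemma 5.2], which by that lemma is the solution of the Apéry-like recurrence (1.1)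
`(n+1)⁵ρ_{n+1} − 32(2n+1)(8n⁴+16n³+20n²+12n+3)ρ_n + 2¹⁶n⁵ρ_{n−1} = 0` with `ρ_0 = 1`, `ρ_1 = 96`
(and `ρ_{n,3} = 768 ρ_n` is the `ζ₂(5)`-coefficient of their linear forms).
[cite: LaiSprangZudilin2026, Lemma 5.2 (display), §1 (1.1)] -/
def lszRho (n : ℕ) : ℕ :=
  ∑ k ∈ range (n + 1), ∑ i ∈ range (k + 1),
    2 ^ (4 * (n - k)) * (2 * i).choose i ^ 2 * (2 * n - 2 * i).choose (n - i) *
      (2 * k - 2 * i).choose (k - i) * (2 * k).choose k ^ 2 * (2 * n - 2 * k).choose (n - k)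

/-- `ρ_0 = 1`. [cite: LaiSprangZudilin2026, §1 (1.1) («{ρ_0, ρ_1, ρ_2, …} = {1, 96, 14944, …}»)] -/
theorem lszRho_zero : lszRho 0 = 1 := by
  decide

/-- `ρ_1 = 96`. [cite: LaiSprangZudilin2026, §1 (1.1) («{ρ_0, ρ_1, ρ_2, …} = {1, 96, 14944, …}»)] -/
theorem lszRho_one : lszRho 1 = 96 := by
  decide

/-- `ρ_2 = 14944`. [cite: LaiSprangZudilin2026, §1 (1.1) («{ρ_0, ρ_1, ρ_2, …} = {1, 96, 14944, …}»)] -/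
theorem lszRho_two : lszRho 2 = 14944 := by
  decide

/-! ## Composition variables: `ρ_n` as a specialised factorial ratio of binomial type -/

/-- Bottom forms `𝐮_j` (= co-bottom forms: all seven binomials are central, `C(2y, y) = C(y + y, y)`) of the
summand of `ρ_n` in the variables `(x₀,x₁,x₂) = (i, k−i, n−k)`: `y = i, i, k−i, n−k, k, k, n−i`.
[cite: LaiSprangZudilin2026, Lemma 5.2] [cite: AdamczewskiBellDelaygue2019, §8.3 (`Q_{e,f}`)] -/
def uRho : Fin 7 → Fin 3 → ℕ :=
  ![![1, 0, 0], ![1, 0, 0], ![0, 1, 0], ![0, 0, 1], ![1, 1, 0], ![1, 1, 0], ![0, 1, 1]]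

/-- The weights `𝐛 = (1, 1, 16)`: `2^{4(n−k)} = 16^{x₂}`. [cite: LaiSprangZudilin2026, Lemma 5.2]
[cite: AdamczewskiBellDelaygue2019, Prop. 7.4 (specialisation `x_i ↦ b_i x`)] -/
def bRho : Fin 3 → ℤ := ![1, 1, 16]

/-- The factorial ratio at a composition: `Q(𝐱) = C(2x₀,x₀)² C(2x₁,x₁) C(2x₂,x₂) C(2(x₀+x₁),x₀+x₁)² C(2(x₁+x₂),x₁+x₂)`.
[cite: LaiSprangZudilin2026, Lemma 5.2] -/
theorem binomProd_uRho (x : Fin 3 → ℕ) :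
    binomProd uRho uRho x =
      (2 * x 0).choose (x 0) ^ 2 * (2 * x 1).choose (x 1) * (2 * x 2).choose (x 2) *
        (2 * (x 0 + x 1)).choose (x 0 + x 1) ^ 2 * (2 * (x 1 + x 2)).choose (x 1 + x 2) := by
  simp only [binomProd, Fin.prod_univ_seven, dot, Fin.sum_univ_three, uRho, Matrix.cons_val_zero,
    Matrix.cons_val_one, Matrix.cons_val, one_mul, zero_mul, add_zero, zero_add, ← two_mul]
  ring

/-- `𝐛^𝐱 = 16^{x₂}`. [cite: LaiSprangZudilin2026, Lemma 5.2] -/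
theorem prod_bRho_pow (x : Fin 3 → ℕ) : ∏ j, bRho j ^ x j = 16 ^ x 2 := by
  simp [Fin.prod_univ_three, bRho]

/-- **`ρ_n = Σ_{|𝐱| = n} 𝐛^𝐱 Q(𝐱)`**: the double sum of Lemma 5.2 re-indexed by the compositions
`(i, k−i, n−k)` of `n`. [cite: LaiSprangZudilin2026, Lemma 5.2] [cite: AdamczewskiBellDelaygue2019, Prop. 7.4] -/
theorem lszRho_eq_spec (n : ℕ) : (lszRho n : ℤ) = spec bRho (binomProd uRho uRho) n := by
  unfold lszRho spec
  rw [sum_sigma']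
  push_cast
  refine sum_nbij' (fun ki => ![ki.2, ki.1 - ki.2, n - ki.1]) (fun x => ⟨x 0 + x 1, x 0⟩) ?_ ?_ ?_ ?_ ?_
  · rintro ⟨k, i⟩ hki
    simp only [mem_sigma, mem_range] at hki
    simp only [Nat.mem_antidiagonalTuple, Fin.sum_univ_three, Matrix.cons_val_zero, Matrix.cons_val_one,
      Matrix.cons_val]
    omega
  · intro x hx
    simp only [Nat.mem_antidiagonalTuple, Fin.sum_univ_three] at hx
    simp only [mem_sigma, mem_range]
    omega
  · rintro ⟨k, i⟩ hki
    simp only [mem_sigma, mem_range] at hki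
    simp only [Matrix.cons_val_zero, Matrix.cons_val_one, Sigma.mk.injEq, heq_eq_eq, and_true]
    omega
  · intro x hx
    simp only [Nat.mem_antidiagonalTuple, Fin.sum_univ_three] at hx
    ext j
    fin_cases j
    · simp
    · simp
    · simp only [Fin.reduceFinMk, Matrix.cons_val]
      omega
  · rintro ⟨k, i⟩ hki
    simp only [mem_sigma, mem_range] at hki
    rw [prod_bRho_pow, binomProd_uRho]
    simp only [Matrix.cons_val_zero, Matrix.cons_val_one, Matrix.cons_val]
    have h1 : i + (k - i) = k := by omega
    have h2 : k - i + (n - k) = n - i := by omega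
    have h3 : 2 * n - 2 * i = 2 * (n - i) := by omega
    have h4 : 2 * k - 2 * i = 2 * (k - i) := by omega
    have h5 : 2 * n - 2 * k = 2 * (n - k) := by omega
    have h6 : (2 : ℤ) ^ (4 * (n - k)) = 16 ^ (n - k) := by
      rw [pow_mul]; norm_num
    rw [h1, h2, h3, h4, h5, h6]
    push_cast
    ring

/-! ## The carry hypotheses of [AdamczewskiBellDelaygue2019, Props. 8.7, 7.4], at every `p` -/

/-- `(a + b) mod p = a mod p + b mod p` when the units digits do not carry. [folklore] -/
private theorem add_mod_of_lt {p : ℕ} (a b : ℕ) (h : a % p + b % p < p) : (a + b) % p = a % p + b % p := by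
  rw [Nat.add_mod, Nat.mod_eq_of_lt h]

/-- The carry bookkeeping for `ρ_n`: with digits `v_i < p`, if none of the seven additions `𝐮_j·𝐯 + 𝐮_j·𝐯` carries
out of the units digit, then `2(v₀ + v₁) < p` and `2(v₁ + v₂) < p` (the binomials `C(2x₀,x₀)`, `C(2x₁,x₁)`,
`C(2x₂,x₂)` force `2v_i < p`, whence `v₀+v₁, v₁+v₂ < p` are their own residues, and `C(2(x₀+x₁),x₀+x₁)`,
`C(2(x₁+x₂),x₁+x₂)` force the rest).
[cite: AdamczewskiBellDelaygue2019, Prop. 8.7 (hypothesis `Δ ≥ 1 on 𝒟`)] -/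
theorem noCarryRho {p : ℕ} (v : Fin 3 → ℕ) (hv : ∀ i, v i < p)
    (h : ∀ j, dot (uRho j) v % p + dot (uRho j) v % p < p) :
    2 * (v 0 + v 1) < p ∧ 2 * (v 1 + v 2) < p := by
  have h0 := h 0
  have h2 := h 2
  have h3 := h 3
  have h4 := h 4
  have h6 := h 6
  simp only [dot, uRho, Fin.sum_univ_three, Matrix.cons_val_zero, Matrix.cons_val_one,
    Matrix.cons_val, one_mul, zero_mul, add_zero, zero_add] at h0 h2 h3 h4 h6
  have e0 : v 0 % p = v 0 := Nat.mod_eq_of_lt (hv 0)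
  have e1 : v 1 % p = v 1 := Nat.mod_eq_of_lt (hv 1)
  have e2 : v 2 % p = v 2 := Nat.mod_eq_of_lt (hv 2)
  have f01 : v 0 + v 1 < p := by omega
  have e01 : (v 0 + v 1) % p = v 0 + v 1 := Nat.mod_eq_of_lt f01
  have f12 : v 1 + v 2 < p := by omega
  have e12 : (v 1 + v 2) % p = v 1 + v 2 := Nat.mod_eq_of_lt f12
  constructor <;> omega

/-- «`Δ_{e,f} ≥ 1` on `𝒟_{e,f}`» for the factorial ratio of `ρ_n`, at every `p`.
[cite: AdamczewskiBellDelaygue2019, Prop. 8.7 (hypothesis)] -/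
theorem carryHypRho {p : ℕ} : CarryHyp uRho uRho p := by
  intro v hv htop
  by_contra hno
  push Not at hno
  obtain ⟨hA, hB⟩ := noCarryRho v hv hno
  simp only [Fin.exists_fin_succ, IsEmpty.exists_iff, or_false, dot, uRho, Fin.sum_univ_three,
    Matrix.cons_val_zero, Matrix.cons_val_succ, Matrix.cons_val_one, Matrix.cons_val, one_mul, zero_mul,
    add_zero, zero_add] at htop
  omega

/-- «`(1,1,1) ∈ 𝒩`» for the factorial ratio of `ρ_n`, at every `p`.
[cite: AdamczewskiBellDelaygue2019, Prop. 7.4 (hypothesis)] -/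
theorem sumCarryHypRho {p : ℕ} : SumCarryHyp uRho uRho p := by
  intro v hv hsum
  by_contra hno
  push Not at hno
  obtain ⟨hA, hB⟩ := noCarryRho v hv hno
  rw [Fin.sum_univ_three] at hsum
  omega

/-! ## Lucas congruences for `ρ_n` -/

section Lucas

variable {p : ℕ} [hp : Fact p.Prime]

/-- **Lucas congruence for `ρ_n`, one digit**: for every prime `p` and `0 ≤ n₀ < p`,
`ρ_{n₀ + pN} ≡ ρ_{n₀} · ρ_N (mod p)`.
[cite: LaiSprangZudilin2026, Lemma 5.2] [cite: AdamczewskiBellDelaygue2019, Props. 7.4, 8.7] -/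
theorem lszRho_modEq_mul (n₀ N : ℕ) (hn₀ : n₀ < p) :
    (lszRho (n₀ + p * N) : ℤ) ≡ lszRho n₀ * lszRho N [ZMOD p] := by
  rw [lszRho_eq_spec, lszRho_eq_spec, lszRho_eq_spec]
  exact spec_binomProd_modEq_mul uRho uRho bRho carryHypRho sumCarryHypRho n₀ N hn₀

/-- The same congruence in `ℕ`: `ρ_{n₀ + pN} ≡ ρ_{n₀} ρ_N (mod p)`.
[cite: LaiSprangZudilin2026, Lemma 5.2] [cite: AdamczewskiBellDelaygue2019, Props. 7.4, 8.7] -/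
theorem lszRho_natModEq_mul (n₀ N : ℕ) (hn₀ : n₀ < p) :
    lszRho (n₀ + p * N) ≡ lszRho n₀ * lszRho N [MOD p] := by
  have h := lszRho_modEq_mul n₀ N hn₀
  unfold Int.ModEq at h
  unfold Nat.ModEq
  exact_mod_cast h

/-- **Lucas congruence for `ρ_n`, all digits**: for every prime `p`, `ρ_n ≡ ∏_i ρ_{n_i} (mod p)` over the
base-`p` digits `n_i` of `n`.
[cite: LaiSprangZudilin2026, Lemma 5.2] [cite: AdamczewskiBellDelaygue2019, Props. 7.4, 8.7] -/
theorem lszRho_modEq_prod_digits (n : ℕ) :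
    (lszRho n : ℤ) ≡ ((Nat.digits p n).map fun m => (lszRho m : ℤ)).prod [ZMOD p] := by
  have e : (fun m => (lszRho m : ℤ)) = spec bRho (binomProd uRho uRho) := funext lszRho_eq_spec
  rw [e, lszRho_eq_spec]
  exact spec_binomProd_modEq_prod_digits uRho uRho bRho carryHypRho sumCarryHypRho n

end Lucas

end Literature.Combinatorics.Enumerative.TwoAdicZetaFiveAperyLikeLucas
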